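import Summits.CriticalPhenomena.PercolationContinuityZ3.Theorems.Transplant.TargetsOfBoxProdZ2
import Summits.CriticalPhenomena.PercolationContinuityZ3.Theorems.Transplant.BoxProdZ2Tubes
import Summits.CriticalPhenomena.PercolationContinuityZ3.Theorems.Transplant.CubicLatticesPlanarSkeleton
import Summits.CriticalPhenomena.PercolationContinuityZ3.Theorems.Transplant.BccPlanarSkeleton
import Summits.CriticalPhenomena.PercolationContinuityZ3.Theorems.Transplant.Zd3PlanarSkeleton
import Summits.CriticalPhenomena.PercolationContinuityZ3.Theorems.Transplant.HeisenbergPlanarSkeleton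
import HarnessLib

/-!
# The lane's typed top in ONE theorem: everything that follows from the single named node `SamePWitnessOfSkeleton`

builds on p205010 (kernel theorem, internal audit signed; external expert review pending).
Status sentence (coordinator 2026-08-20T04:30Z): "θ(p_c) = 0 on ℤ^d, all d ≥ 2 — kernel-verified (Lean 4/Mathlib,
standard axioms); internal adversarial audit SIGNED 2026-08-20 04:29Z; external expert review pending."

Lane `prim-bschramm-*`, seat `prim-bschramm-stmt`.  PROOF-ONLY packaging (no new mathematics): the conjecture node `SamePWitnessOfSkeleton`
(`Transplant/PlanarSkeletonDefs.lean`, p209682 — Kozma–Nitzan §4 re-typed in skeleton coordinates; a DESIGN target, NOT a theorem, never asserted)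
implies, by theorems of the tree landed by the lane's seats on 2026-08-20:
Benjamini–Schramm's Conjecture 4 for every product `X □ ℤ²` (`X` infinite connected locally finite quasi-transitive; lead, p211018), the fcc and bcc
lattices at their own critical points (stmt, p210173 / p210280), the Heisenberg group `H₃(ℤ)` and `H₃(ℤ) □ ℤ²` (lead/p3, p209990 / p211018), every
`ℤ^d × F` (`d ≥ 3`, `F` finite connected) and every slab `S_k ⊂ ℤ^d` (`d ≥ 3`) at their own critical points (stmt p210898 / p211238 + p2's
`SlabProdIso`), and — as a sanity check — p205010's own `d = 3` case `PercolationContinuity 3` (stmt, p210525).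
* `skeletonNode_consequences` — the conjunction (box products are referred to through the named `Prop`s only). [cite: BenjaminiSchramm1996, Conj. 4] [cite: KozmaNitzan2024, §4 pp. 15–31]
-/

noncomputable section

namespace Summit.CriticalPhenomena.PercolationContinuityZ3.Theorems.Transplant

open MeasureTheory Literature.Probability.Percolation Literature.Probability.LatticeModels

/-- **ONE NODE ⇒ the lane's targets**: `SamePWitnessOfSkeleton` implies `BSConj4_boxProdZ2` (all `X □ ℤ²`), `FccOwnCriticalContinuity`,
`BccOwnCriticalContinuity`, `HeisenbergCriticalContinuity`, `HeisenbergZ2CriticalContinuity`, `ZdTimesFiniteOwnCriticalContinuity d` and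
`SlabOwnCriticalContinuity d` for all `d ≥ 3`, and (sanity) `PercolationContinuity 3` — builds on p205010 (kernel theorem, internal audit signed;
external expert review pending) for the near-one gluing inside the node's intended proof, NOT for these implications, which are tree theorems.
[cite: BenjaminiSchramm1996, Conj. 4] [cite: KozmaNitzan2024, §4] -/
theorem skeletonNode_consequences (hW : SamePWitnessOfSkeleton) :
    BSConj4_boxProdZ2 ∧ FccOwnCriticalContinuity ∧ BccOwnCriticalContinuity ∧ HeisenbergCriticalContinuity ∧
      HeisenbergZ2.HeisenbergZ2CriticalContinuity ∧ (∀ d : ℕ, 3 ≤ d → ZdTimesFiniteOwnCriticalContinuity d) ∧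
      (∀ (d : ℕ) [NeZero d], 3 ≤ d → SlabOwnCriticalContinuity d) ∧ PercolationContinuity 3 :=
  ⟨bsConj4_boxProdZ2_of_skeletonNode' hW, fccOwnCriticalContinuity_of_skeletonNode hW, bccOwnCriticalContinuity_of_skeletonNode hW,
    heisenbergCriticalContinuity_of_skeletonNode hW, heisenbergZ2CriticalContinuity_of_skeletonNode hW,
    fun d hd => zdTimesFiniteOwnCriticalContinuity_of_bsConj4_boxProdZ2 d hd (bsConj4_boxProdZ2_of_skeletonNode' hW),
    fun d _ hd => slabOwnCriticalContinuity_of_bsConj4_boxProdZ2' d hd (bsConj4_boxProdZ2_of_skeletonNode' hW),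
    percolationContinuity_three_of_skeletonNode hW⟩

end Summit.CriticalPhenomena.PercolationContinuityZ3.Theorems.Transplant
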